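import Literature.Barriers.CriticalPhenomena.RigorousRGSmallParameterPerturbativeBetaLimit
import HarnessLib

/-!
# `RigorousRGSmallParameter` (Slade, Theorem 1.4.1): Lemma 5.2.3 in the massless case and the
# convergence `β^:_j(0) → a` of the coefficient of the transformed flow

Twelfth file of the §10.3–§10.4 layer. G. Slade, *Critical exponents for long-range `O(n)` models
below the upper critical dimension*, Commun. Math. Phys. **358** (2018), §5.2: "`β^:_j = β_j +
4(η_{≥j}w̄_j^{(1)} - η_{≥j+1}w̄_{j+1}^{(1)})` … **Lemma 5.2.3.** … There exists `z > 0` such that,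
uniformly in `m² ∈ [0,m̄²]` and `1 ≤ j ≤ j_m`, with a possibly `L`-dependent constant, (5.27)
`|β^:_j - β_j| ≤ O(L^{-zj} + L^{-z(j_m-j)})`." Proof in §10.4: "`|β^:_j - β_j| ≤ |η_{≥j} - η_{≥j+1}|
|w̄_j^{(1)}| + |η_{≥j+1}||w̄_j^{(1)} - w̄_{j+1}^{(1)}| ≲ |η_{≥j} - η_{≥j+1}| + |w̄_j^{(1)} - w̄_{j+1}^{(1)}|` …
`f_j = (1/(n+2))(η_{≥j} - η_{≥j+1}) = L^{(d-α)j}Σ_{i≥j}(C_{i+1;0,0}(m²) - L^{d-α}C_{i+2;0,0})` … By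
Lemma 10.3.1, `f_j = L^{(d-α)j}Σ_{i≥j}L^{-(d-α)(i+1)}(q_i - q_{i+1}) + O(L^{-j})` [with `q_i =
c₀(0,m²L^{αi})`] … `w̄^{(1)}_{j+1} - w̄^{(1)}_j = L^{-α(j+1)}Σ_{i=1}^{j+1}C_i^{(1)} -
L^{-αj}Σ_{i=1}^jC_i^{(1)}`. Let `Q_i = ∫c₀(y,m²L^{αi})dy`. By Lemma 10.3.1, and by Riemann sum
approximation, (10.52) `C_i^{(1)} = L^{-(d-α)i}(Σ_xc₀(xL^{-i},m²L^{αi}) + L^{di}O(L^{-i})) =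
L^{αi}(Q_i + O(L^{-i}))` …".

This file treats the MASSLESS case `m² = 0` (so `j_m = ∞`, `q_i ≡ c₀(0,0)`, `Q_i ≡ Q = ∫c₀(y,0)dy`
and only the lattice term `L^{-zj}` of (5.27) survives): the leading terms cancel exactly and
`|β^:_j(0) - β_j(0)| ≤ C(j+1)(L^j)^{-(α∧1)}`; combined with Lemma 5.2.2
(`RigorousRGSmallParameterPerturbativeBetaLimit.lean`) this gives `|β^:_j(0) - a| ≤
C(j+1)(L^j)^{-(α∧1)}`, the massless case of Lemma 5.2.4. The general-mass asymptotics (10.52) of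
`C_i^{(1)}` is proved for every `m²` (input of the massive case).

## What this file proves (everything; one definition `FRD.cZeroInt`, no named fact)

* `FRD.cZeroInt` (`Q(A) = ∫c₀(y,A)dy`), `FRD.abs_cZeroInt_le`; **`FRD.sum_fracCov_asymp`** —
  **(10.52), PROVED for all masses**: `|Σ_xC_{i;0,x}(m²) - (L^i)^αQ(m²(L^i)^α)| ≤ C(L^i)^α(L^i)⁻¹`
  (`i ≥ 2`).
* **`FRD.abs_etaGe_sub_le_massless`** — `|η_{≥j}(0) - η_{≥j+1}(0)| ≤ C(L^j)⁻¹` (`j ≥ 1`).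
* `FRD.wOne_eq_sum` (`w_j^{(1)} = Σ_{i≤j}C_i^{(1)}`), `FRD.rpow_err_le'`,
  **`FRD.abs_wbarOne_sub_le_massless`** — `|w̄^{(1)}_{j+1}(0) - w̄^{(1)}_j(0)| ≤ C(j+1)(L^j)^{-(α∧1)}`.
* **`FRD.Slade2017_lem523_massless`** — Lemma 5.2.3 at `m² = 0`:
  `|β^:_j(0) - β_j(0)| ≤ C(j+1)(L^j)^{-(α∧1)}` (`j ≥ 1`).
* **`FRD.abs_betaWCoeff_sub_aCoeff_le_massless`** — `|β^:_j(0) - a| ≤ C(j+1)(L^j)^{-(α∧1)}` (`j ≥ 1`).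
-/

noncomputable section

namespace Literature.Barriers.CriticalPhenomena

open _root_.MeasureTheory Set Filter
open scoped _root_.Topology Real

namespace LongRangePhi4

namespace FRD

open Literature.Probability.LatticeModels

variable {d : ℕ}

/-! ### `C_i^{(1)} = Σ_x C_{i;0,x} = (L^i)^α(Q_i + O(L^{-i}))` -/

/-- **`Q(A) = ∫_{ℝ^d} c₀(y,A) dy`** (Slade's `Q_i = ∫c₀(y, m²L^{αi})dy` is `Q(m²L^{αi})`).
[cite: Slade2017, Lemma 5.2.3 (proof, §10.4: "Let Q_i = ∫c₀(y,m²L^{αi})dy")] -/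
def cZeroInt (d : ℕ) (L α A : ℝ) : ℝ := ∫ y : Fin d → ℝ, cZero d L α y A

/-- **(10.52): `C_i^{(1)} = L^{-(d-α)i}(Σ_xc₀(xL^{-i},m²L^{αi}) + L^{di}O(L^{-i})) = L^{αi}(Q_i + O(L^{-i}))`**,
PROVED: for `d ≥ 1`, `α ∈ (0,2)`, `L ≥ 2` there is `C` with
`|Σ_{|x|₁<½L^i}C_{i;0,x}(m²) - (L^i)^αQ(m²(L^i)^α)| ≤ C(L^i)^α(L^i)⁻¹` for all `i ≥ 2` and all `m²`
(Lemma 10.3.1 and the Riemann sum of the Lipschitz, compactly supported `c₀(·,A)`).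
[cite: Slade2017, Lemma 5.2.3 (proof, §10.4, display (10.52))] -/
theorem sum_fracCov_asymp (hd : 1 ≤ d) {α : ℝ} (hα0 : 0 < α) (hα2 : α < 2) {L : ℝ} (hL : 2 ≤ L) :
    ∃ C : ℝ, 0 < C ∧ ∀ i : ℕ, 2 ≤ i → ∀ m2 : ℝ,
      |∑ x ∈ PT.ball (L ^ i / 2), fracCov d L α m2 i x - (L ^ i) ^ α * cZeroInt d L α (m2 * (L ^ i) ^ α)| ≤
        C * (L ^ i) ^ α * (L ^ i)⁻¹ := by
  have hd' : (1 : ℝ) ≤ d := by exact_mod_cast hd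
  have hL1 : (1 : ℝ) ≤ L := by linarith
  have hL0 : (0 : ℝ) < L := by linarith
  obtain ⟨C₁, hC₁, h31⟩ := Slade2017_lem1031 hd hα0 hα2 hL
  obtain ⟨Lc, hLc, hlip⟩ := abs_cZero_sub_le hd hα0 hα2 hL1
  refine ⟨Lc * 4 ^ d + 2 ^ d * C₁, by positivity, fun i hi m2 => ?_⟩
  set Λ : ℝ := L ^ i with hΛ
  have hΛ0 : 0 < Λ := pow_pos hL0 i
  have hΛ1 : 1 ≤ Λ := one_le_pow₀ hL1
  set A : ℝ := m2 * Λ ^ α with hA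
  -- `C_i(x) = Λ^{α-d}(c₀(x/Λ,A) + E(x))`, `|E| ≤ C₁Λ⁻¹`
  set c : Site d → ℝ := fun x => cZero d L α (fun k => (x k : ℝ) / Λ) A with hc
  set E : Site d → ℝ := fun x => Λ ^ ((d : ℝ) - α) * fracCov d L α m2 i x - c x with hE
  have hinv : Λ ^ ((d : ℝ) - α) * Λ ^ (α - d) = 1 := by rw [← Real.rpow_add hΛ0]; simp
  have hpk : 0 < Λ ^ (α - d) := Real.rpow_pos_of_pos hΛ0 _
  have hCi : ∀ x, fracCov d L α m2 i x = Λ ^ (α - d) * (c x + E x) := by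
    intro x; simp only [hE]
    calc fracCov d L α m2 i x = (Λ ^ ((d : ℝ) - α) * Λ ^ (α - d)) * fracCov d L α m2 i x := by rw [hinv, one_mul]
      _ = _ := by ring
  have hEb : ∀ x, |E x| ≤ C₁ * Λ⁻¹ := by
    intro x
    have h := h31 i hi m2 x
    rw [← hΛ] at h
    have hp : 0 < Λ ^ ((d : ℝ) - α) := Real.rpow_pos_of_pos hΛ0 _
    have e : E x = Λ ^ ((d : ℝ) - α) * (fracCov d L α m2 i x - Λ ^ (α - d) * c x) := by
      simp only [hE, hc, hA]
      calc Λ ^ ((d : ℝ) - α) * fracCov d L α m2 i x - cZero d L α (fun k => (x k : ℝ) / Λ) (m2 * Λ ^ α)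
          = Λ ^ ((d : ℝ) - α) * fracCov d L α m2 i x -
            (Λ ^ ((d : ℝ) - α) * Λ ^ (α - d)) * cZero d L α (fun k => (x k : ℝ) / Λ) (m2 * Λ ^ α) := by
              rw [hinv, one_mul]
        _ = _ := by ring
    rw [e, abs_mul, abs_of_pos hp]
    calc Λ ^ ((d : ℝ) - α) * |fracCov d L α m2 i x - Λ ^ (α - d) * c x|
        ≤ Λ ^ ((d : ℝ) - α) * (C₁ * Λ ^ (α - d) * Λ⁻¹) := mul_le_mul_of_nonneg_left h hp.le
      _ = C₁ * Λ⁻¹ * (Λ ^ ((d : ℝ) - α) * Λ ^ (α - d)) := by ring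
      _ = C₁ * Λ⁻¹ := by rw [hinv, mul_one]
  -- Riemann sum for `F = c₀(·,A)`
  have hlipF : ∀ y y' : Fin d → ℝ, |cZero d L α y A - cZero d L α y' A| ≤ Lc * ‖y - y'‖ := hlip A
  have hsuppF : ∀ y : Fin d → ℝ, 1 / 2 < ‖y‖ → cZero d L α y A = 0 := fun y hy =>
    cZero_eq_zero_of_norm_gt hd hα0 hα2 hL hy A
  obtain ⟨-, hR⟩ := abs_riemannSum_sub_integral_le hLc.le (by norm_num : (0 : ℝ) ≤ 1 / 2) hlipF hsuppF hΛ1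
  set B : Finset (Site d) := PT.ball (Λ / 2) with hB
  have hsumF : ∑ x ∈ PT.box (Λ * (1 / 2) + 1), cZero d L α (fun k => (x k : ℝ) / Λ) A = ∑ x ∈ B, c x := by
    symm
    refine Finset.sum_subset (fun x hx => PT.mem_box_of_lt (by have := PT.mem_ball.1 hx; linarith))
      (fun x _ hx => ?_)
    rw [hB, PT.mem_ball, not_lt] at hx
    refine cZero_eq_zero_of_half_le hd hα0 hα2 hL ?_ A
    have e : ∑ k, |((x k : ℤ) : ℝ) / Λ| = ((∑ k, (x k).natAbs : ℕ) : ℝ) / Λ := by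
      push_cast
      rw [Finset.sum_div]
      refine Finset.sum_congr rfl fun k _ => ?_
      rw [abs_div, abs_of_pos hΛ0, ← Int.cast_natCast, Int.natCast_natAbs, Int.cast_abs]
    rw [e, le_div_iff₀ hΛ0]
    linarith
  rw [hsumF] at hR
  have hR' : |∑ x ∈ B, c x - Λ ^ d * cZeroInt d L α A| ≤ Lc * 4 ^ d * Λ⁻¹ * Λ ^ d := by
    have hΛd : 0 < Λ ^ d := pow_pos hΛ0 d
    have e : ∑ x ∈ B, c x - Λ ^ d * cZeroInt d L α A = Λ ^ d * ((Λ ^ d)⁻¹ * ∑ x ∈ B, c x - cZeroInt d L α A) := by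
      unfold cZeroInt; field_simp
    rw [e, abs_mul, abs_of_pos hΛd, mul_comm]
    refine mul_le_mul_of_nonneg_right (hR.trans (le_of_eq ?_)) hΛd.le
    norm_num
  -- cardinality and the error sum
  have hcard : ((B.card : ℕ) : ℝ) ≤ (2 * Λ) ^ d := by
    refine (PT.card_ball_le (by positivity)).trans ?_
    apply pow_le_pow_left₀ (by positivity); linarith
  have hEs : |∑ x ∈ B, E x| ≤ (2 * Λ) ^ d * (C₁ * Λ⁻¹) := by
    calc |∑ x ∈ B, E x| ≤ ∑ x ∈ B, |E x| := Finset.abs_sum_le_sum_abs _ _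
      _ ≤ ∑ _x ∈ B, C₁ * Λ⁻¹ := Finset.sum_le_sum fun x _ => hEb x
      _ = B.card * (C₁ * Λ⁻¹) := by rw [Finset.sum_const, nsmul_eq_mul]
      _ ≤ (2 * Λ) ^ d * (C₁ * Λ⁻¹) := mul_le_mul_of_nonneg_right hcard (by positivity)
  -- assemble
  have hexp : ∑ x ∈ B, fracCov d L α m2 i x = Λ ^ (α - d) * ((∑ x ∈ B, c x) + ∑ x ∈ B, E x) := by
    rw [← Finset.sum_add_distrib, Finset.mul_sum]
    exact Finset.sum_congr rfl fun x _ => hCi x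
  have hpow : Λ ^ (α - d) * Λ ^ d = Λ ^ α := by
    rw [← Real.rpow_natCast Λ d, ← Real.rpow_add hΛ0]; ring_nf
  rw [hexp]
  have e2 : Λ ^ (α - d) * ((∑ x ∈ B, c x) + ∑ x ∈ B, E x) - Λ ^ α * cZeroInt d L α A =
      Λ ^ (α - d) * ((∑ x ∈ B, c x - Λ ^ d * cZeroInt d L α A) + ∑ x ∈ B, E x) := by
    rw [← hpow]; ring
  rw [e2, abs_mul, abs_of_pos hpk]
  have h2d : (2 * Λ) ^ d = 2 ^ d * Λ ^ d := mul_pow _ _ _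
  calc Λ ^ (α - d) * |(∑ x ∈ B, c x - Λ ^ d * cZeroInt d L α A) + ∑ x ∈ B, E x|
      ≤ Λ ^ (α - d) * (Lc * 4 ^ d * Λ⁻¹ * Λ ^ d + (2 * Λ) ^ d * (C₁ * Λ⁻¹)) :=
        mul_le_mul_of_nonneg_left ((abs_add_le _ _).trans (add_le_add hR' hEs)) hpk.le
    _ = (Lc * 4 ^ d + 2 ^ d * C₁) * (Λ ^ (α - d) * Λ ^ d) * Λ⁻¹ := by rw [h2d]; ring
    _ = (Lc * 4 ^ d + 2 ^ d * C₁) * Λ ^ α * Λ⁻¹ := by rw [hpow]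

/-- `|Q(A)| ≤ C₀` (`|c₀| ≤ C₀`, support in the unit cube). [cite: Slade2017, §10.4 (display (10.52))] -/
theorem abs_cZeroInt_le (hd : 1 ≤ d) {α : ℝ} (hα0 : 0 < α) (hα2 : α < 2) {L : ℝ} (hL : 2 ≤ L) :
    ∃ C₀ : ℝ, 0 < C₀ ∧ ∀ A : ℝ, |cZeroInt d L α A| ≤ C₀ := by
  have hL1 : (1 : ℝ) ≤ L := by linarith
  obtain ⟨C₀, hC₀, hb⟩ := abs_cZero_le hd hα0 hα2 hL1
  refine ⟨C₀, hC₀, fun A => ?_⟩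
  unfold cZeroInt
  have hsupp : Function.support (fun y : Fin d → ℝ => cZero d L α y A) ⊆ Metric.closedBall (0 : Fin d → ℝ) (1 / 2) := by
    intro y hy
    rw [Metric.mem_closedBall, dist_zero_right]
    by_contra h
    exact hy (cZero_eq_zero_of_norm_gt hd hα0 hα2 hL (lt_of_not_ge h) A)
  rw [← setIntegral_eq_integral_of_forall_compl_eq_zero (s := Metric.closedBall (0 : Fin d → ℝ) (1 / 2))
    fun y hy => Function.notMem_support.1 fun h => hy (hsupp h)]
  have hfin : volume (Metric.closedBall (0 : Fin d → ℝ) (1 / 2)) < ⊤ := by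
    rw [Real.volume_pi_closedBall _ (by norm_num)]; exact ENNReal.ofReal_lt_top
  have h := norm_setIntegral_le_of_norm_le_const hfin (C := C₀) fun y _ => by
    rw [Real.norm_eq_abs]; exact hb A y
  rw [Real.norm_eq_abs] at h
  refine h.trans ?_
  rw [Measure.real, Real.volume_pi_closedBall _ (by norm_num), ENNReal.toReal_ofReal (by positivity)]
  norm_num

/-! ### The massless cancellations: `η_{≥j}(0) - η_{≥j+1}(0) = O(L^{-j})` -/

/-- **`|η_{≥j}(0) - η_{≥j+1}(0)| ≤ CL^{-j}`** (massless; `d ≥ 1`, `α ∈ (0,2∧d)`, `L ≥ 2`, `j ≥ 1`):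
`f_j = L^{(d-α)j}Σ_{i≥j}(C_{i+1;0,0} - L^{d-α}C_{i+2;0,0})` and, by Lemma 10.3.1 at `x = 0`, `m² = 0`,
the leading terms `L^{-(d-α)(i+1)}c₀(0,0)` cancel exactly ("`f_j = L^{(d-α)j}Σ_{i≥j}L^{-(d-α)(i+1)}
(q_i - q_{i+1}) + O(L^{-j})`" with `q_i ≡ c₀(0,0)`).
[cite: Slade2017, Lemma 5.2.3 (proof, §10.4, displays (10.49)–(10.51), massless case)] -/
theorem abs_etaGe_sub_le_massless (hd : 1 ≤ d) (n : ℕ) {α : ℝ} (hα0 : 0 < α) (hα2 : α < 2)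
    (hαd : α < d) {L : ℝ} (hL : 2 ≤ L) :
    ∃ C : ℝ, 0 < C ∧ ∀ j : ℕ, 1 ≤ j →
      |PT.etaGe d n L α 0 j - PT.etaGe d n L α 0 (j + 1)| ≤ C * (L ^ j)⁻¹ := by
  have hd' : (1 : ℝ) ≤ d := by exact_mod_cast hd
  have hL1 : (1 : ℝ) ≤ L := by linarith
  have hL0 : (0 : ℝ) < L := by linarith
  obtain ⟨C₁, hC₁, h31⟩ := Slade2017_lem1031 hd hα0 hα2 hL
  obtain ⟨c', -, hsum⟩ := PT.summable_etaGe_and_abs_le hd n hα0 hα2 hαd (le_refl (0 : ℝ))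
  set ρ : ℝ := L ^ ((d : ℝ) - α) with hρ
  have hρ0 : 0 < ρ := Real.rpow_pos_of_pos hL0 _
  set θ : ℝ := L ^ (α - d - 1) with hθ
  have hθ0 : 0 < θ := Real.rpow_pos_of_pos hL0 _
  have hθ1 : θ < 1 := Real.rpow_lt_one_of_one_lt_of_neg (by linarith) (by linarith)
  refine ⟨(n + 2) * (2 * C₁) * θ / (1 - θ), by
    have : 0 < 1 - θ := by linarith
    positivity, fun j hj => ?_⟩
  -- summability of `k ↦ η'_{j+k}` and the closed form `η_{≥j} = ρ^j Σ_k η'_{j+k}`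
  have hsm : ∀ j : ℕ, Summable fun k : ℕ => PT.etaPrime d n L α 0 (j + k) := by
    intro j
    have h := (hsum L hL 0 le_rfl le_rfl j).1
    have e : (fun k : ℕ => (ρ ^ k)⁻¹ * PT.etaCoeff d n L α 0 (j + k)) =
        fun k => ρ ^ j * PT.etaPrime d n L α 0 (j + k) := by
      funext k
      unfold PT.etaCoeff
      rw [← hρ, pow_add]
      field_simp
    rw [e] at h
    have := h.mul_left ((ρ ^ j)⁻¹)
    refine this.congr fun k => ?_
    field_simp
  have hge : ∀ j : ℕ, PT.etaGe d n L α 0 j = ρ ^ j * ∑' k : ℕ, PT.etaPrime d n L α 0 (j + k) := by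
    intro j
    unfold PT.etaGe
    rw [← tsum_mul_left]
    refine tsum_congr fun k => ?_
    unfold PT.etaCoeff
    rw [← hρ, pow_add]
    field_simp
  -- the differences `η'_i - ρ η'_{i+1}` for `i ≥ 1`
  have hdiff : ∀ i : ℕ, 1 ≤ i →
      |PT.etaPrime d n L α 0 i - ρ * PT.etaPrime d n L α 0 (i + 1)| ≤ (n + 2) * (2 * C₁) * θ ^ (i + 1) := by
    intro i hi
    unfold PT.etaPrime
    have h1 := h31 (i + 1) (by omega) 0 0
    have h2 := h31 (i + 2) (by omega) 0 0
    rw [zero_mul] at h1 h2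
    simp only [Pi.zero_apply, Int.cast_zero, zero_div] at h1 h2
    set q : ℝ := cZero d L α (fun _ : Fin d => (0 : ℝ)) 0 with hq
    set Λ₁ : ℝ := L ^ (i + 1) with hΛ₁
    set Λ₂ : ℝ := L ^ (i + 2) with hΛ₂
    have hΛ₁0 : 0 < Λ₁ := pow_pos hL0 _
    have hΛ₂0 : 0 < Λ₂ := pow_pos hL0 _
    -- `ρ Λ₂^{α-d} = Λ₁^{α-d}`
    have hρΛ : ρ * Λ₂ ^ (α - d) = Λ₁ ^ (α - d) := by
      rw [hρ, hΛ₂, hΛ₁, ← Real.rpow_natCast L (i + 2), ← Real.rpow_natCast L (i + 1),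
        ← Real.rpow_mul hL0.le, ← Real.rpow_mul hL0.le, ← Real.rpow_add hL0]
      congr 1; push_cast; ring
    have e : fracCov d L α 0 (i + 1) 0 - ρ * fracCov d L α 0 (i + 2) 0 =
        (fracCov d L α 0 (i + 1) 0 - Λ₁ ^ (α - d) * q) - ρ * (fracCov d L α 0 (i + 2) 0 - Λ₂ ^ (α - d) * q) := by
      rw [mul_sub, ← mul_assoc, hρΛ]; ring
    have hn2 : (0 : ℝ) < n + 2 := by positivity
    rw [show (n + 2 : ℝ) * fracCov d L α 0 (i + 1) 0 - ρ * ((n + 2) * fracCov d L α 0 (i + 1 + 1) 0) =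
      (n + 2) * (fracCov d L α 0 (i + 1) 0 - ρ * fracCov d L α 0 (i + 2) 0) by ring, abs_mul,
      abs_of_pos hn2, e, mul_assoc]
    refine mul_le_mul_of_nonneg_left ?_ hn2.le
    -- `Λ₁^{α-d}Λ₁⁻¹ = θ^{i+1}`, `ρΛ₂^{α-d}Λ₂⁻¹ = θ^{i+1}θ L^{?}`: bound both by `θ^{i+1}`
    have hθ₁ : Λ₁ ^ (α - d) * Λ₁⁻¹ = θ ^ (i + 1) := by
      rw [hΛ₁, hθ, ← Real.rpow_neg_one, ← Real.rpow_natCast L (i + 1), ← Real.rpow_mul hL0.le,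
        ← Real.rpow_mul hL0.le, ← Real.rpow_add hL0, ← Real.rpow_mul_natCast hL0.le]
      congr 1; push_cast; ring
    have hθ₂ : ρ * (Λ₂ ^ (α - d) * Λ₂⁻¹) = θ ^ (i + 1) * L⁻¹ := by
      rw [← mul_assoc, hρΛ, hΛ₂, hΛ₁, hθ, ← Real.rpow_neg_one, ← Real.rpow_neg_one,
        ← Real.rpow_natCast L (i + 1), ← Real.rpow_natCast L (i + 2), ← Real.rpow_mul hL0.le,
        ← Real.rpow_mul hL0.le, ← Real.rpow_add hL0, ← Real.rpow_mul_natCast hL0.le, ← Real.rpow_add hL0]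
      congr 1; push_cast; ring
    have hLinv : L⁻¹ ≤ 1 := inv_le_one_of_one_le₀ hL1
    calc |(fracCov d L α 0 (i + 1) 0 - Λ₁ ^ (α - d) * q) - ρ * (fracCov d L α 0 (i + 2) 0 - Λ₂ ^ (α - d) * q)|
        ≤ |fracCov d L α 0 (i + 1) 0 - Λ₁ ^ (α - d) * q| + |ρ * (fracCov d L α 0 (i + 2) 0 - Λ₂ ^ (α - d) * q)| :=
          abs_sub _ _
      _ ≤ C₁ * Λ₁ ^ (α - d) * Λ₁⁻¹ + ρ * (C₁ * Λ₂ ^ (α - d) * Λ₂⁻¹) := by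
          rw [abs_mul, abs_of_pos hρ0]
          exact add_le_add h1 (mul_le_mul_of_nonneg_left h2 hρ0.le)
      _ = C₁ * θ ^ (i + 1) + C₁ * (θ ^ (i + 1) * L⁻¹) := by
          rw [mul_assoc C₁, hθ₁, show ρ * (C₁ * Λ₂ ^ (α - d) * Λ₂⁻¹) = C₁ * (ρ * (Λ₂ ^ (α - d) * Λ₂⁻¹)) by ring, hθ₂]
      _ ≤ 2 * C₁ * θ ^ (i + 1) := by
          have : θ ^ (i + 1) * L⁻¹ ≤ θ ^ (i + 1) := mul_le_of_le_one_right (by positivity) hLinv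
          nlinarith [pow_pos hθ0 (i + 1)]
  -- the difference of the two series
  have hsub : PT.etaGe d n L α 0 j - PT.etaGe d n L α 0 (j + 1) =
      ρ ^ j * ∑' k : ℕ, (PT.etaPrime d n L α 0 (j + k) - ρ * PT.etaPrime d n L α 0 (j + k + 1)) := by
    rw [hge j, hge (j + 1), pow_succ, mul_assoc, ← mul_sub, ← tsum_mul_left,
      ← (hsm j).tsum_sub ((hsm (j + 1)).mul_left ρ)]
    congr 1
    refine tsum_congr fun k => ?_
    rw [show j + 1 + k = j + k + 1 by omega]
  have h1θ : 0 < 1 - θ := by linarith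
  have hmaj : HasSum (fun k : ℕ => (n + 2) * (2 * C₁) * θ ^ (j + k + 1)) ((n + 2) * (2 * C₁) * (θ ^ (j + 1) / (1 - θ))) := by
    have h := (hasSum_geometric_of_lt_one hθ0.le hθ1).mul_left ((n + 2) * (2 * C₁) * θ ^ (j + 1))
    have e : (fun k : ℕ => (n + 2) * (2 * C₁) * θ ^ (j + 1) * θ ^ k) = fun k => (n + 2) * (2 * C₁) * θ ^ (j + k + 1) := by
      funext k; rw [show j + k + 1 = (j + 1) + k by omega, pow_add]; ring
    rw [e, show (n + 2 : ℝ) * (2 * C₁) * θ ^ (j + 1) * (1 - θ)⁻¹ = (n + 2) * (2 * C₁) * (θ ^ (j + 1) / (1 - θ)) by ring] at h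
    exact h
  have htb : |∑' k : ℕ, (PT.etaPrime d n L α 0 (j + k) - ρ * PT.etaPrime d n L α 0 (j + k + 1))| ≤
      (n + 2) * (2 * C₁) * (θ ^ (j + 1) / (1 - θ)) := by
    have h := tsum_of_norm_bounded hmaj fun k => (by
      rw [Real.norm_eq_abs]
      exact hdiff (j + k) (by omega) :
        ‖PT.etaPrime d n L α 0 (j + k) - ρ * PT.etaPrime d n L α 0 (j + k + 1)‖ ≤ (n + 2) * (2 * C₁) * θ ^ (j + k + 1))
    rwa [Real.norm_eq_abs] at h
  -- `ρ^j θ^{j+1} = θ (L^j)⁻¹`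
  have hρθ : ρ ^ j * θ ^ (j + 1) = θ * (L ^ j)⁻¹ := by
    rw [hρ, hθ, ← Real.rpow_mul_natCast hL0.le, ← Real.rpow_mul_natCast hL0.le, ← Real.rpow_add hL0,
      ← Real.rpow_natCast L j, ← Real.rpow_neg hL0.le, ← Real.rpow_add hL0]
    congr 1; push_cast; ring
  rw [hsub, abs_mul, abs_of_pos (pow_pos hρ0 j)]
  calc ρ ^ j * |∑' k : ℕ, (PT.etaPrime d n L α 0 (j + k) - ρ * PT.etaPrime d n L α 0 (j + k + 1))|
      ≤ ρ ^ j * ((n + 2) * (2 * C₁) * (θ ^ (j + 1) / (1 - θ))) := mul_le_mul_of_nonneg_left htb (pow_pos hρ0 j).le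
    _ = (n + 2) * (2 * C₁) / (1 - θ) * (ρ ^ j * θ ^ (j + 1)) := by field_simp
    _ = (n + 2) * (2 * C₁) * θ / (1 - θ) * (L ^ j)⁻¹ := by rw [hρθ]; field_simp

/-! ### The massless cancellations: `w̄^{(1)}_{j+1}(0) - w̄^{(1)}_j(0) = O(jL^{-(α∧1)j})` -/

/-- `C_i^{(1)} = Σ_{|x|₁<½L^i}C_{i;0,x}` and `w_j^{(1)} = Σ_{i=1}^jC_i^{(1)}`.
[cite: Slade2017, Lemma 5.2.3 (proof, §10.4: "w̄^{(1)}_{j+1} - w̄^{(1)}_j = L^{-α(j+1)}Σ_{i=1}^{j+1}C_i^{(1)} - L^{-αj}Σ_{i=1}^jC_i^{(1)}")] -/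
theorem wOne_eq_sum (hd : 1 ≤ d) {L : ℝ} (hL : 1 ≤ L) (α m2 : ℝ) (j : ℕ) :
    PT.wOne d L α m2 j = ∑ i ∈ Finset.Icc 1 j, ∑ x ∈ PT.ball (L ^ i / 2), fracCov d L α m2 i x := by
  unfold PT.wOne
  rw [PT.powSum_eq_sum (S := PT.ball (L ^ j / 2))
    (fun x hx => PT.wCov_eq_zero_of_not_mem_ball hd hL α m2 le_rfl hx) one_ne_zero]
  simp_rw [pow_one]
  unfold PT.wCov
  rw [Finset.sum_comm]
  refine Finset.sum_congr rfl fun i hi => ?_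
  rw [Finset.mem_Icc] at hi
  symm
  refine Finset.sum_subset (fun x hx => ?_) (fun x _ hx => ?_)
  · rw [PT.mem_ball] at hx ⊢
    exact lt_of_lt_of_le hx (div_le_div_of_nonneg_right (pow_le_pow_right₀ hL hi.2) (by norm_num))
  · exact PT.fracCov_eq_zero_of_not_mem_ball hd hL α m2 le_rfl hx

/-- For `1 ≤ L`, `i ≤ j`: `(L^j)^{-α}(L^i)^{α-1} ≤ (L^j)^{-(α∧1)}`. [folklore] -/
theorem rpow_err_le' {L : ℝ} (hL : 1 ≤ L) (α : ℝ) {i j : ℕ} (hij : i ≤ j) :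
    (L ^ j) ^ (-α) * (L ^ i) ^ (α - 1) ≤ (L ^ j) ^ (-min α 1) := by
  have hL0 : 0 < L := by linarith
  rw [← Real.rpow_natCast L i, ← Real.rpow_mul hL0.le, ← Real.rpow_natCast L j, ← Real.rpow_mul hL0.le,
    ← Real.rpow_add hL0, ← Real.rpow_mul hL0.le]
  apply Real.rpow_le_rpow_of_exponent_le hL
  have hij' : (i : ℝ) ≤ j := by exact_mod_cast hij
  have hi0 : (0 : ℝ) ≤ i := Nat.cast_nonneg i
  rcases le_or_gt α 1 with hα1 | hα1
  · rw [min_eq_left hα1]; nlinarith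
  · rw [min_eq_right hα1.le]; nlinarith

/-- **`|w̄^{(1)}_{j+1}(0) - w̄^{(1)}_j(0)| ≤ C(j+1)(L^j)^{-(α∧1)}`** (massless; `j ≥ 1`): with
`C_i^{(1)} = L^{αi}(Q + O(L^{-i}))`, `Q = ∫c₀(y,0)dy`, the leading contributions of
`L^{-α(j+1)}Σ_{i≤j+1}C_i^{(1)}` and `L^{-αj}Σ_{i≤j}C_i^{(1)}` cancel up to `QL^{α}(L^α)^{-j}`
("(10.53): `|w̄^{(1)}_{j+1} - w̄^{(1)}_j| ≤ |L^{-αj}Σ_{i=0}^jL^{αi}Q_{i+1} - L^{-αj}Σ_{i=1}^jL^{αi}Q_i| +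
L^{-z'j}`", here with `Q_i ≡ Q`). [cite: Slade2017, Lemma 5.2.3 (proof, §10.4, displays (10.52)–(10.53), massless case)] -/
theorem abs_wbarOne_sub_le_massless (hd : 1 ≤ d) {α : ℝ} (hα0 : 0 < α) (hα2 : α < 2) (hαd : α < d)
    {L : ℝ} (hL : 2 ≤ L) :
    ∃ C : ℝ, 0 < C ∧ ∀ j : ℕ, 1 ≤ j →
      |PT.wbarOne d L α 0 (j + 1) - PT.wbarOne d L α 0 j| ≤ C * (j + 1) * (L ^ j) ^ (-min α 1) := by
  have hd' : (1 : ℝ) ≤ d := by exact_mod_cast hd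
  have hL1 : (1 : ℝ) ≤ L := by linarith
  have hL0 : (0 : ℝ) < L := by linarith
  obtain ⟨C₂, hC₂, hS⟩ := sum_fracCov_asymp hd hα0 hα2 hL
  obtain ⟨C₀, hC₀, hQb⟩ := abs_cZeroInt_le hd hα0 hα2 hL
  obtain ⟨c, hc, hCb⟩ := PT.abs_fracCov_le_massFactor hd hα0 hα2 hαd (le_refl (0 : ℝ))
  set a : ℝ := L ^ α with ha
  have ha1 : 1 < a := Real.one_lt_rpow (by linarith) hα0
  have ha0 : 0 < a := by linarith
  set Q : ℝ := cZeroInt d L α 0 with hQ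
  set m : ℝ := min α 1 with hm
  -- constants: `B₁` bounds `C_1^{(1)}`
  set B₁ : ℝ := (L + 1) ^ d * c with hB₁
  refine ⟨|Q| * a + C₂ + B₁ + C₂ + |Q| * a ^ 2 / (a - 1) + 1, by
    have : 0 < a - 1 := by linarith
    positivity, fun j hj => ?_⟩
  have hΛ1 : (1 : ℝ) ≤ L ^ j := one_le_pow₀ hL1
  have hΛ0 : (0 : ℝ) < L ^ j := by positivity
  have hΛm0 : 0 < (L ^ j) ^ (-m) := Real.rpow_pos_of_pos hΛ0 _
  have hαm : (L ^ j) ^ (-α) ≤ (L ^ j) ^ (-m) := Real.rpow_le_rpow_of_exponent_le hΛ1 (by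
    have := min_le_left α 1; linarith)
  have h1m : (L ^ j)⁻¹ ≤ (L ^ j) ^ (-m) := by
    rw [← Real.rpow_neg_one]; exact Real.rpow_le_rpow_of_exponent_le hΛ1 (by have := min_le_right α 1; linarith)
  -- notation
  set C1 : ℕ → ℝ := fun i => ∑ x ∈ PT.ball (L ^ i / 2), fracCov d L α 0 i x with hC1
  set T : ℕ → ℝ := fun j => ∑ i ∈ Finset.Icc 1 j, C1 i with hT
  have hw : ∀ j, PT.wbarOne d L α 0 j = (a ^ j)⁻¹ * T j := by
    intro j
    unfold PT.wbarOne
    rw [PT.scaleMin_of_not_pos (lt_irrefl (0 : ℝ)), wOne_eq_sum hd hL1 α 0 j]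
  -- `C_i^{(1)} = a^i (Q + e_i)`, `|e_i| ≤ C₂ (L^i)⁻¹` for `i ≥ 2`
  have hai : ∀ i : ℕ, (L ^ i) ^ α = a ^ i := fun i => PT.pow_rpow_comm hL0.le i α
  have hm2i : ∀ i : ℕ, (0 : ℝ) * (L ^ i) ^ α = 0 := fun i => zero_mul _
  have he : ∀ i : ℕ, 2 ≤ i → |C1 i - a ^ i * Q| ≤ C₂ * a ^ i * (L ^ i)⁻¹ := by
    intro i hi
    have h := hS i hi 0
    rw [hm2i, hai] at h
    exact h
  -- `|C_1^{(1)}| ≤ B₁`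
  have hC11 : |C1 1| ≤ B₁ := by
    have hmass : PT.massFactor L α 0 1 = 1 := by simp [PT.massFactor]
    calc |C1 1| ≤ ∑ x ∈ PT.ball (L ^ 1 / 2), |fracCov d L α 0 1 x| := Finset.abs_sum_le_sum_abs _ _
      _ ≤ ∑ _x ∈ PT.ball (L ^ 1 / 2), c := Finset.sum_le_sum fun x _ => by
          have := hCb L hL 0 le_rfl le_rfl 1 le_rfl x
          simpa [hmass] using this
      _ = (PT.ball (d := d) (L ^ 1 / 2)).card * c := by rw [Finset.sum_const, nsmul_eq_mul]
      _ ≤ (L + 1) ^ d * c := by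
          refine mul_le_mul_of_nonneg_right ((PT.card_ball_le (by positivity)).trans (le_of_eq ?_)) hc.le
          rw [pow_one]; ring
  -- decomposition of `T_j` for `j ≥ 1`: `T_j = C1 1 + Q Σ_{i=2}^j a^i + Σ_{i=2}^j (C1 i - a^i Q)`
  have hIoc : Finset.Ioc 1 j = Finset.Icc 2 j := by
    ext i; simp only [Finset.mem_Ioc, Finset.mem_Icc]; omega
  have hTj : T j = C1 1 + Q * ∑ i ∈ Finset.Icc 2 j, a ^ i + ∑ i ∈ Finset.Icc 2 j, (C1 i - a ^ i * Q) := by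
    simp only [hT]
    rw [Finset.Icc_eq_cons_Ioc hj, Finset.sum_cons, hIoc, Finset.mul_sum, add_assoc, ← Finset.sum_add_distrib]
    congr 1
    refine Finset.sum_congr rfl fun i _ => by ring
  -- geometric sum `Σ_{i=2}^j a^i = (a^{j+1} - a^2)/(a - 1)`
  have hgeom : ∑ i ∈ Finset.Icc 2 j, a ^ i = (a ^ (j + 1) - a ^ 2) / (a - 1) := by
    have h := geom_sum_eq (x := a) (by linarith : a ≠ 1) (j + 1)
    have hsplit : ∑ i ∈ Finset.range (j + 1), a ^ i = (∑ i ∈ Finset.range 2, a ^ i) + ∑ i ∈ Finset.Icc 2 j, a ^ i := by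
      rw [← Finset.sum_range_add_sum_Ico _ (by omega : 2 ≤ j + 1)]
      congr 1
    rw [hsplit] at h
    have e2 : ∑ i ∈ Finset.range 2, a ^ i = 1 + a := by simp [Finset.sum_range_succ]
    rw [e2] at h
    have hne : a - 1 ≠ 0 := by linarith
    field_simp
    have := h
    field_simp at this
    linarith
  -- the difference
  have hΔ : PT.wbarOne d L α 0 (j + 1) - PT.wbarOne d L α 0 j =
      (a ^ (j + 1))⁻¹ * C1 (j + 1) + ((a ^ (j + 1))⁻¹ - (a ^ j)⁻¹) * T j := by
    rw [hw, hw]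
    simp only [hT]
    rw [Finset.sum_Icc_succ_top (by omega : 1 ≤ j + 1)]
    ring
  -- main cancellation
  have hmain : (a ^ (j + 1))⁻¹ * (a ^ (j + 1) * Q) + ((a ^ (j + 1))⁻¹ - (a ^ j)⁻¹) * (Q * ((a ^ (j + 1) - a ^ 2) / (a - 1))) =
      Q * a * (a ^ j)⁻¹ := by
    have hne : a - 1 ≠ 0 := by linarith
    have haj : a ^ j ≠ 0 := pow_ne_zero _ ha0.ne'
    have haj1 : a ^ (j + 1) ≠ 0 := pow_ne_zero _ ha0.ne'
    field_simp
    ring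
  rw [hΔ, hTj]
  have e1 : (a ^ (j + 1))⁻¹ * C1 (j + 1) + ((a ^ (j + 1))⁻¹ - (a ^ j)⁻¹) *
      (C1 1 + Q * ∑ i ∈ Finset.Icc 2 j, a ^ i + ∑ i ∈ Finset.Icc 2 j, (C1 i - a ^ i * Q)) =
      Q * a * (a ^ j)⁻¹ + (a ^ (j + 1))⁻¹ * (C1 (j + 1) - a ^ (j + 1) * Q) +
        ((a ^ (j + 1))⁻¹ - (a ^ j)⁻¹) * (C1 1 + ∑ i ∈ Finset.Icc 2 j, (C1 i - a ^ i * Q)) := by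
    rw [hgeom, ← hmain]; ring
  rw [e1]
  -- bounds on the three pieces
  have haj0 : 0 < a ^ j := pow_pos ha0 j
  have haj10 : 0 < a ^ (j + 1) := pow_pos ha0 (j + 1)
  have hajm : (a ^ j)⁻¹ = (L ^ j) ^ (-α) := by rw [ha, ← PT.pow_rpow_comm hL0.le, Real.rpow_neg hΛ0.le]
  have hfac : |(a ^ (j + 1))⁻¹ - (a ^ j)⁻¹| ≤ (a ^ j)⁻¹ := by
    have h1 : (a ^ (j + 1))⁻¹ ≤ (a ^ j)⁻¹ := inv_anti₀ haj0 (pow_le_pow_right₀ ha1.le (by omega))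
    rw [abs_sub_comm, abs_of_nonneg (by linarith)]
    have : 0 ≤ (a ^ (j + 1))⁻¹ := by positivity
    linarith
  have hp1 : |Q * a * (a ^ j)⁻¹| ≤ |Q| * a * (L ^ j) ^ (-m) := by
    rw [abs_mul, abs_mul, abs_of_pos ha0, abs_of_pos (inv_pos.2 haj0), hajm]
    exact mul_le_mul_of_nonneg_left hαm (by positivity)
  have hp2 : |(a ^ (j + 1))⁻¹ * (C1 (j + 1) - a ^ (j + 1) * Q)| ≤ C₂ * (L ^ j) ^ (-m) := by
    rw [abs_mul, abs_of_pos (inv_pos.2 haj10)]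
    calc (a ^ (j + 1))⁻¹ * |C1 (j + 1) - a ^ (j + 1) * Q| ≤ (a ^ (j + 1))⁻¹ * (C₂ * a ^ (j + 1) * (L ^ (j + 1))⁻¹) :=
          mul_le_mul_of_nonneg_left (he (j + 1) (by omega)) (by positivity)
      _ = C₂ * (L ^ (j + 1))⁻¹ := by field_simp
      _ ≤ C₂ * (L ^ j) ^ (-m) := by
          refine mul_le_mul_of_nonneg_left (le_trans ?_ h1m) hC₂.le
          exact inv_anti₀ hΛ0 (pow_le_pow_right₀ hL1 (by omega))
  have hp3 : |((a ^ (j + 1))⁻¹ - (a ^ j)⁻¹) * (C1 1 + ∑ i ∈ Finset.Icc 2 j, (C1 i - a ^ i * Q))| ≤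
      (B₁ + C₂ * j) * (L ^ j) ^ (-m) := by
    rw [abs_mul]
    have hsumb : (a ^ j)⁻¹ * |∑ i ∈ Finset.Icc 2 j, (C1 i - a ^ i * Q)| ≤ C₂ * j * (L ^ j) ^ (-m) := by
      calc (a ^ j)⁻¹ * |∑ i ∈ Finset.Icc 2 j, (C1 i - a ^ i * Q)|
          ≤ (a ^ j)⁻¹ * ∑ i ∈ Finset.Icc 2 j, |C1 i - a ^ i * Q| :=
            mul_le_mul_of_nonneg_left (Finset.abs_sum_le_sum_abs _ _) (by positivity)
        _ ≤ (a ^ j)⁻¹ * ∑ i ∈ Finset.Icc 2 j, C₂ * a ^ i * (L ^ i)⁻¹ :=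
            mul_le_mul_of_nonneg_left (Finset.sum_le_sum fun i hi => he i (Finset.mem_Icc.1 hi).1) (by positivity)
        _ = ∑ i ∈ Finset.Icc 2 j, C₂ * ((L ^ j) ^ (-α) * (L ^ i) ^ (α - 1)) := by
            rw [Finset.mul_sum]
            refine Finset.sum_congr rfl fun i _ => ?_
            rw [hajm, ← hai i, Real.rpow_sub_one (pow_pos hL0 i).ne', div_eq_mul_inv]
            ring
        _ ≤ ∑ _i ∈ Finset.Icc 2 j, C₂ * (L ^ j) ^ (-m) := Finset.sum_le_sum fun i hi =>
            mul_le_mul_of_nonneg_left (rpow_err_le' hL1 α (Finset.mem_Icc.1 hi).2) hC₂.le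
        _ = (j - 1 : ℕ) * (C₂ * (L ^ j) ^ (-m)) := by rw [Finset.sum_const, Nat.card_Icc, nsmul_eq_mul]; congr 1
        _ ≤ j * (C₂ * (L ^ j) ^ (-m)) := by
            refine mul_le_mul_of_nonneg_right ?_ (by positivity)
            exact_mod_cast Nat.sub_le j 1
        _ = C₂ * j * (L ^ j) ^ (-m) := by ring
    calc |(a ^ (j + 1))⁻¹ - (a ^ j)⁻¹| * |C1 1 + ∑ i ∈ Finset.Icc 2 j, (C1 i - a ^ i * Q)|
        ≤ (a ^ j)⁻¹ * (|C1 1| + |∑ i ∈ Finset.Icc 2 j, (C1 i - a ^ i * Q)|) :=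
          mul_le_mul hfac (abs_add_le _ _) (abs_nonneg _) (by positivity)
      _ = (a ^ j)⁻¹ * |C1 1| + (a ^ j)⁻¹ * |∑ i ∈ Finset.Icc 2 j, (C1 i - a ^ i * Q)| := by ring
      _ ≤ B₁ * (L ^ j) ^ (-m) + C₂ * j * (L ^ j) ^ (-m) := by
          refine add_le_add ?_ hsumb
          rw [hajm]
          calc (L ^ j) ^ (-α) * |C1 1| ≤ (L ^ j) ^ (-m) * B₁ :=
                mul_le_mul hαm hC11 (abs_nonneg _) hΛm0.le
            _ = B₁ * (L ^ j) ^ (-m) := mul_comm _ _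
      _ = (B₁ + C₂ * j) * (L ^ j) ^ (-m) := by ring
  have hj0 : (0 : ℝ) ≤ j := Nat.cast_nonneg j
  calc |Q * a * (a ^ j)⁻¹ + (a ^ (j + 1))⁻¹ * (C1 (j + 1) - a ^ (j + 1) * Q) +
        ((a ^ (j + 1))⁻¹ - (a ^ j)⁻¹) * (C1 1 + ∑ i ∈ Finset.Icc 2 j, (C1 i - a ^ i * Q))|
      ≤ |Q| * a * (L ^ j) ^ (-m) + C₂ * (L ^ j) ^ (-m) + (B₁ + C₂ * j) * (L ^ j) ^ (-m) :=
        (abs_add_le _ _).trans (add_le_add ((abs_add_le _ _).trans (add_le_add hp1 hp2)) hp3)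
    _ = (|Q| * a + C₂ + B₁ + C₂ * j) * (L ^ j) ^ (-m) := by ring
    _ ≤ (|Q| * a + C₂ + B₁ + C₂ + |Q| * a ^ 2 / (a - 1) + 1) * (j + 1) * (L ^ j) ^ (-m) := by
        refine mul_le_mul_of_nonneg_right ?_ hΛm0.le
        have h4 : 0 < a - 1 := by linarith
        have h5 : 0 ≤ |Q| * a ^ 2 / (a - 1) := by positivity
        have h6 : 0 ≤ |Q| * a := by positivity
        have h7 : 0 ≤ B₁ := by rw [hB₁]; positivity
        have hX : 0 ≤ |Q| * a + C₂ + B₁ := by positivity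
        nlinarith [mul_nonneg hX hj0, mul_nonneg h5 hj0]

/-! ### `β^:_j(0) - β_j(0)` and `β^:_j(0) → a` -/

/-- **Slade, Lemma 5.2.3 in the massless case, PROVED**: for `d ≥ 1`, `α ∈ (0,2)`, `α < d`,
`L ≥ 2` there is `C` with `|β^:_j(0) - β_j(0)| ≤ C(j+1)(L^j)^{-(α∧1)}` for all `j ≥ 1`
("`|β^:_j - β_j| ≤ |η_{≥j} - η_{≥j+1}||w̄^{(1)}_j| + |η_{≥j+1}||w̄^{(1)}_j - w̄_{j+1}^{(1)}|`"; at
`m² = 0` the mass scale is infinite and only the lattice term `L^{-zj}` of (5.27) is present).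
[cite: Slade2017, Lemma 5.2.3 (display (5.27)) and its proof, §10.4 (display after "Proof of Lemma 5.2.3"), massless case] -/
theorem Slade2017_lem523_massless (hd : 1 ≤ d) (n : ℕ) {α : ℝ} (hα0 : 0 < α) (hα2 : α < 2)
    (hαd : α < d) {L : ℝ} (hL : 2 ≤ L) :
    ∃ C : ℝ, 0 < C ∧ ∀ j : ℕ, 1 ≤ j →
      |PT.betaWCoeff d n L α 0 j - PT.betaCoeff d n L α 0 j| ≤ C * (j + 1) * (L ^ j) ^ (-min α 1) := by
  have hL1 : (1 : ℝ) ≤ L := by linarith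
  have hL0 : (0 : ℝ) < L := by linarith
  obtain ⟨Cη, hCη, hη⟩ := abs_etaGe_sub_le_massless hd n hα0 hα2 hαd hL
  obtain ⟨Cw, hCw, hw⟩ := abs_wbarOne_sub_le_massless hd hα0 hα2 hαd hL
  obtain ⟨c, hc, hcore⟩ := PT.Slade2017_lem521_core hd n hα0 hα2 hαd (le_refl (0 : ℝ)) hL
  refine ⟨4 * (Cη * c + c * Cw), by positivity, fun j hj => ?_⟩
  have hΛ1 : (1 : ℝ) ≤ L ^ j := one_le_pow₀ hL1
  have hΛ0 : (0 : ℝ) < L ^ j := by positivity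
  have hΛm0 : 0 < (L ^ j) ^ (-min α 1) := Real.rpow_pos_of_pos hΛ0 _
  have h1m : (L ^ j)⁻¹ ≤ (L ^ j) ^ (-min α 1) := by
    rw [← Real.rpow_neg_one]; exact Real.rpow_le_rpow_of_exponent_le hΛ1 (by have := min_le_right α 1; linarith)
  have hmass : ∀ i, PT.massFactor L α 0 i = 1 := fun i => by simp [PT.massFactor]
  obtain ⟨-, hge1, -, -, hwb⟩ := hcore 0 le_rfl le_rfl j
  obtain ⟨-, hge2, -, -, -⟩ := hcore 0 le_rfl le_rfl (j + 1)
  rw [hmass, mul_one] at hge1 hge2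
  have hdη := hη j hj
  have hdw := hw j hj
  unfold PT.betaWCoeff betaW
  rw [show PT.betaCoeff d n L α 0 j + 4 * (PT.etaGe d n L α 0 j * PT.wbarOne d L α 0 j -
      PT.etaGe d n L α 0 (j + 1) * PT.wbarOne d L α 0 (j + 1)) - PT.betaCoeff d n L α 0 j =
      4 * ((PT.etaGe d n L α 0 j - PT.etaGe d n L α 0 (j + 1)) * PT.wbarOne d L α 0 j -
        PT.etaGe d n L α 0 (j + 1) * (PT.wbarOne d L α 0 (j + 1) - PT.wbarOne d L α 0 j)) by ring,
    abs_mul, abs_of_pos (by norm_num : (0 : ℝ) < 4)]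
  have hj0 : (1 : ℝ) ≤ j + 1 := by linarith [Nat.cast_nonneg (α := ℝ) j]
  calc 4 * |(PT.etaGe d n L α 0 j - PT.etaGe d n L α 0 (j + 1)) * PT.wbarOne d L α 0 j -
        PT.etaGe d n L α 0 (j + 1) * (PT.wbarOne d L α 0 (j + 1) - PT.wbarOne d L α 0 j)|
      ≤ 4 * (|PT.etaGe d n L α 0 j - PT.etaGe d n L α 0 (j + 1)| * |PT.wbarOne d L α 0 j| +
          |PT.etaGe d n L α 0 (j + 1)| * |PT.wbarOne d L α 0 (j + 1) - PT.wbarOne d L α 0 j|) := by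
        refine mul_le_mul_of_nonneg_left ((abs_sub _ _).trans ?_) (by norm_num)
        rw [abs_mul, abs_mul]
    _ ≤ 4 * (Cη * (L ^ j)⁻¹ * c + c * (Cw * (j + 1) * (L ^ j) ^ (-min α 1))) := by
        gcongr
    _ ≤ 4 * (Cη * c * ((j + 1) * (L ^ j) ^ (-min α 1)) + c * (Cw * (j + 1) * (L ^ j) ^ (-min α 1))) := by
        gcongr 4 * (?_ + _)
        rw [mul_assoc, mul_comm ((L ^ j)⁻¹) c, ← mul_assoc]
        refine mul_le_mul_of_nonneg_left ?_ (by positivity)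
        calc (L ^ j)⁻¹ ≤ (L ^ j) ^ (-min α 1) := h1m
          _ ≤ (j + 1) * (L ^ j) ^ (-min α 1) := le_mul_of_one_le_left hΛm0.le hj0
    _ = 4 * (Cη * c + c * Cw) * (j + 1) * (L ^ j) ^ (-min α 1) := by ring

/-- **`β^:_j(0) → a` with rate**: `|β^:_j(0) - a| ≤ C(j+1)(L^j)^{-(α∧1)}` for `j ≥ 1` (Lemmas 5.2.2 and
5.2.3 at `m² = 0`) — the massless case of Lemma 5.2.4 ("For the intermediate scales … the
difference between `β^:_j(m²)` and `a` is well controlled"). [cite: Slade2017, Lemma 5.2.4 (proof: "|β^:_j - a| ≤ |β^:_j - β_j| + |β_j(m²) - β_j(0)| + |β_j(0) - a|"), massless case] -/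
theorem abs_betaWCoeff_sub_aCoeff_le_massless (hd : 1 ≤ d) (n : ℕ) {α : ℝ} (hα0 : 0 < α) (hα2 : α < 2)
    (hαd : α < d) {L : ℝ} (hL : 2 ≤ L) :
    ∃ C : ℝ, 0 < C ∧ ∀ j : ℕ, 1 ≤ j →
      |PT.betaWCoeff d n L α 0 j - aCoeff d n L α| ≤ C * (j + 1) * (L ^ j) ^ (-min α 1) := by
  obtain ⟨-, C₁, hC₁, h₁⟩ := Slade2017_lem522 hd n hα0 hα2 hαd hL
  obtain ⟨C₂, hC₂, h₂⟩ := Slade2017_lem523_massless hd n hα0 hα2 hαd hL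
  refine ⟨C₁ + C₂, by positivity, fun j hj => ?_⟩
  calc |PT.betaWCoeff d n L α 0 j - aCoeff d n L α|
      ≤ |PT.betaWCoeff d n L α 0 j - PT.betaCoeff d n L α 0 j| + |PT.betaCoeff d n L α 0 j - aCoeff d n L α| :=
        abs_sub_le _ _ _
    _ ≤ C₂ * (j + 1) * (L ^ j) ^ (-min α 1) + C₁ * (j + 1) * (L ^ j) ^ (-min α 1) := add_le_add (h₂ j hj) (h₁ j hj)
    _ = (C₁ + C₂) * (j + 1) * (L ^ j) ^ (-min α 1) := by ring

end FRD

end LongRangePhi4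

end Literature.Barriers.CriticalPhenomena
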